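import Literature.Probability.Distributions.BrascampLiebHalfLine
import Literature.NumberTheory.LFunctions.JensenXiMomentForm
import Literature.NumberTheory.LFunctions.DeBruijnPhiLogConcave
import HarnessLib

/-!
# The tilted measures `u^k Φ(u) du`: curvature floors and the Brascamp–Lieb bound for the variance
# and the mean (second moment)

`Literature/NumberTheory/LFunctions/`. For `k : ℕ` let `ν_k` be the probability measure on `(0, ∞)`
with density proportional to `u^k Φ(u)` (`Φ = deBruijnPhi`, the Pólya–de Bruijn kernel; its moments
are the tree's `xiMoment`, its mean `xiMean k = ū_k`, its normalised central moments `xiCM k l`,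
and `xiMu n l = xiCM (2n) l · (2n+1)^{l/2}` are the coordinates in which the Jensen polynomials of
`ξ` are certified hyperbolic, `JensenXiMomentForm.lean`). Writing the density as `e^{−W_k}` with the
POTENTIAL `W_k(u) = −(k log u + log Φ(u))` one has

  `W_k′ = −(k/u + Φ′/Φ)`,  `W_k″ = k/u² + V`,  `V := (Φ′² − ΦΦ″)/Φ² = −(log Φ)″ > 16πe^{4u}`

(the last by the quantitative Coffey–Csordas log-concavity `deBruijnPhi_logConcave_quantitative`), so
`W_k` is strictly convex on `(0, ∞)` and Brascamp–Lieb's variance inequality applies. This file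
proves, for a critical point `a` of `W_k` (the mode: `k/a = −Φ′(a)/Φ(a)`) and a two-piece curvature
floor `W_k″ ≥ ρ` on `[b, ∞)`, `W_k″ ≥ ρ′` on `(0, b)`:

* `integral_sq_sub_mul_phi_pow_le`: `∫₀^∞ (u − a)² u^kΦ ≤ ρ⁻¹ M_k + ρ′⁻¹ ∫₀^b u^kΦ`;
* `xiCM_two_mul_sq_xiMean_le`: `m₂(k)·ū_k² ≤ ρ⁻¹ + ρ′⁻¹ P` and `(ū_k − a)² ≤ ρ⁻¹ + ρ′⁻¹ P`,
  `P = (∫₀^b u^kΦ)/M_k` the mass below the cut;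
* `xiMu_two_le_of_curvature`: `μ₂(n) ≤ (2n+1)·B/(a − √B)²` for any `B ≥ ρ⁻¹ + ρ′⁻¹ P` with `√B < a`
  — the upper half of (A1) of the Jensen track's tail lemma (eng-3, LADDER-BL.md (5.1)–(5.4)) with
  the mean–mode step done by Jensen's inequality instead of Cramér–Rao;
* the explicit floors `xiPotential_floor_right` (`ρ = k/c² + 16πe^{4b}` whenever
  `k/c² ≤ 16π(e^{4c} − e^{4b})`) and `xiPotential_floor_left` (`ρ′ = k/b² + 16π`);

What is NOT here: the potential VOCABULARY (`xiPotential`, `xiPotentialDeriv₂`, `xiMode`, … —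
the file `XiTiltedPotential.lean`, whose one-line bridges identify this file's written-out
hypotheses `k/a + Φ′(a)/Φ(a) = 0` and `k/u² + V(u)` with `xiPotentialDeriv k a = 0` and
`xiPotentialDeriv₂ k u`; the calculus facts used below are private helpers), existence / location
of the mode (a hypothesis here), the bound on the left mass `P` (a one-sided tail estimate,
`ConvexPotentialTails.lean`), the normaliser (`XiTiltedNormaliser.lean`), higher moments
(`XiTiltedUnconditioning.lean`). No definitions; `V` is written out.

References: Brascamp–Lieb, J. Funct. Anal. 22 (1976), Thm 4.1 [BrascampLieb1976]; Coffey–Csordas,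
Math. Comp. 82 (2013), Thm 2.4 [CoffeyCsordas2013]; Griffin–Ono–Rolen–Zagier, PNAS 116 (2019),
Thm 7 / §5.1 (the asymptotics `m_l(k) → 0` these bounds make effective) [GORZPNAS2019].
-/

noncomputable section

open MeasureTheory Set Filter
open scoped Topology

namespace Literature.NumberTheory.LFunctions

open Literature.Probability.Distributions

/-! ### The potential `W_k = −(k log u + log Φ)` and its derivatives -/

/-- `e^{−W_k(u)} = Φ(u) u^k` for `u > 0`, `W_k(u) = −(k log u + log Φ(u))` (private helper; the
public potential vocabulary `xiPotential` lives in `XiTiltedPotential.lean`). [folklore] -/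
private theorem exp_neg_xiPotential (k : ℕ) {u : ℝ} (hu : 0 < u) :
    Real.exp (-(-((k : ℝ) * Real.log u + Real.log (deBruijnPhi u)))) = deBruijnPhi u * u ^ k := by
  rw [neg_neg, Real.exp_add, Real.exp_nat_mul, Real.exp_log hu,
    Real.exp_log (deBruijnPhi_pos_holds u)]
  ring

/-- `W_k′(u) = −(k/u + Φ′(u)/Φ(u))` on `(0, ∞)` (private helper). [folklore] -/
private theorem hasDerivAt_xiPotential (k : ℕ) {u : ℝ} (hu : 0 < u) :
    HasDerivAt (fun t => -((k : ℝ) * Real.log t + Real.log (deBruijnPhi t)))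
      (-((k : ℝ) / u + deBruijnPhiDeriv u / deBruijnPhi u)) u := by
  have h1 : HasDerivAt (fun t => (k : ℝ) * Real.log t) ((k : ℝ) * u⁻¹) u :=
    (Real.hasDerivAt_log hu.ne').const_mul _
  have h2 := hasDerivAt_log_deBruijnPhi u
  have h : HasDerivAt (fun t => -((k : ℝ) * Real.log t + Real.log (deBruijnPhi t)))
      (-((k : ℝ) * u⁻¹ + deBruijnPhiDeriv u / deBruijnPhi u)) u := (h1.add h2).neg
  exact h.congr_deriv (by simp only [div_eq_mul_inv])

/-- `W_k″(u) = k/u² + (Φ′² − ΦΦ″)/Φ²` on `(0, ∞)` (private helper). [folklore] -/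
private theorem hasDerivAt_xiPotentialDeriv (k : ℕ) {u : ℝ} (hu : 0 < u) :
    HasDerivAt (fun t => -((k : ℝ) / t + deBruijnPhiDeriv t / deBruijnPhi t))
      ((k : ℝ) / u ^ 2 +
        (deBruijnPhiDeriv u ^ 2 - deBruijnPhi u * deBruijnPhiDeriv₂ u) / deBruijnPhi u ^ 2) u := by
  have h1 : HasDerivAt (fun t => (k : ℝ) / t) ((0 * u - (k : ℝ) * 1) / u ^ 2) u :=
    (hasDerivAt_const u (k : ℝ)).div (hasDerivAt_id' u) hu.ne'
  have h2 := hasDerivAt_deriv_log_deBruijnPhi u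
  have h : HasDerivAt (fun t => -((k : ℝ) / t + deBruijnPhiDeriv t / deBruijnPhi t))
      (-((0 * u - (k : ℝ) * 1) / u ^ 2 +
        (deBruijnPhiDeriv₂ u * deBruijnPhi u - deBruijnPhiDeriv u * deBruijnPhiDeriv u) /
          deBruijnPhi u ^ 2)) u := (h1.add h2).neg
  refine h.congr_deriv ?_
  have hΦ := (deBruijnPhi_pos_holds u).ne'
  have hu' := hu.ne'
  field_simp
  ring

/-- Curvature of the potential: `k/u² + 16πe^{4u} < W_k″(u)` for `u > 0` (private helper; from
`deBruijnPhi_logConcave_quantitative`). [folklore] -/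
private theorem xiPotentialDeriv₂_gt (k : ℕ) {u : ℝ} (hu : 0 < u) :
    (k : ℝ) / u ^ 2 + 16 * Real.pi * Real.exp (4 * u) <
      (k : ℝ) / u ^ 2 +
        (deBruijnPhiDeriv u ^ 2 - deBruijnPhi u * deBruijnPhiDeriv₂ u) / deBruijnPhi u ^ 2 := by
  have h := deBruijnPhi_logConcave_quantitative u
  rw [abs_of_pos hu] at h
  have hΦ := pow_pos (deBruijnPhi_pos_holds u) 2
  have : 16 * Real.pi * Real.exp (4 * u) <
      (deBruijnPhiDeriv u ^ 2 - deBruijnPhi u * deBruijnPhiDeriv₂ u) / deBruijnPhi u ^ 2 := by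
    rw [lt_div_iff₀ hΦ]; linarith
  linarith

/-- `W_k″ > 0` on `(0, ∞)` (private helper). [folklore] -/
private theorem xiPotentialDeriv₂_pos (k : ℕ) {u : ℝ} (hu : 0 < u) :
    0 < (k : ℝ) / u ^ 2 +
        (deBruijnPhiDeriv u ^ 2 - deBruijnPhi u * deBruijnPhiDeriv₂ u) / deBruijnPhi u ^ 2 :=
  lt_trans (by positivity) (xiPotentialDeriv₂_gt k hu)

/-- `Φ″` is continuous (a finite combination of the continuous `expThetaMoment`s). [folklore] -/
private theorem continuous_deBruijnPhiDeriv₂' : Continuous deBruijnPhiDeriv₂ := by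
  have h2 : Continuous fun u : ℝ => 2 * u := continuous_const.mul continuous_id
  unfold deBruijnPhiDeriv₂
  have hA := (continuous_expThetaMoment 2 2).comp h2
  have hB := (continuous_expThetaMoment 3 3).comp h2
  have hC := (continuous_expThetaMoment 1 1).comp h2
  have hD := (continuous_expThetaMoment 4 4).comp h2
  exact (((continuous_const.mul hA).sub (continuous_const.mul hB)).sub
    (continuous_const.mul hC)).add (continuous_const.mul hD)

/-- `W_k″` is continuous on `(0, ∞)` (private helper). [folklore] -/
private theorem continuousOn_xiPotentialDeriv₂ (k : ℕ) :
    ContinuousOn (fun u : ℝ => (k : ℝ) / u ^ 2 +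
        (deBruijnPhiDeriv u ^ 2 - deBruijnPhi u * deBruijnPhiDeriv₂ u) / deBruijnPhi u ^ 2)
      (Ioi 0) := by
  have hΦ : Continuous deBruijnPhi := continuous_deBruijnPhi
  have hΦ' : Continuous deBruijnPhiDeriv := continuous_deBruijnPhiDeriv
  have hΦ'' : Continuous deBruijnPhiDeriv₂ := continuous_deBruijnPhiDeriv₂'
  refine ContinuousOn.add ?_ ?_
  · exact (continuousOn_const.div (continuousOn_id.pow 2) fun x hx => (pow_pos hx 2).ne')
  · exact ((((hΦ'.pow 2).sub (hΦ.mul hΦ'')).div (hΦ.pow 2)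
      fun x => (pow_pos (deBruijnPhi_pos_holds x) 2).ne').continuousOn)

/-! ### Explicit curvature floors -/

/-- **Right floor** (the bulk): if `k/c² ≤ 16π(e^{4c} − e^{4b})` (which forces `b ≤ c` unless
`k = 0`), then `W_k″(u) ≥ k/c² + 16πe^{4b}` for every `u ≥ b`, `u > 0` (for `u ≤ c` both terms
separately; for `u > c` the exponential alone). [cite: GORZPNAS2019, Thm 7 and §5.1] -/
theorem xiPotential_floor_right (k : ℕ) {b c : ℝ}
    (hc : (k : ℝ) / c ^ 2 ≤ 16 * Real.pi * (Real.exp (4 * c) - Real.exp (4 * b))) :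
    ∀ u : ℝ, 0 < u → b ≤ u →
      (k : ℝ) / c ^ 2 + 16 * Real.pi * Real.exp (4 * b) ≤
        (k : ℝ) / u ^ 2 +
          (deBruijnPhiDeriv u ^ 2 - deBruijnPhi u * deBruijnPhiDeriv₂ u) / deBruijnPhi u ^ 2 := by
  intro u hu hbu
  have hlt := xiPotentialDeriv₂_gt k hu
  have hπ : 0 < 16 * Real.pi := by positivity
  rcases le_or_gt u c with huc | huc
  · have h1 : (k : ℝ) / c ^ 2 ≤ (k : ℝ) / u ^ 2 :=
      div_le_div_of_nonneg_left (Nat.cast_nonneg k) (by positivity) (pow_le_pow_left₀ hu.le huc 2)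
    have h2 : Real.exp (4 * b) ≤ Real.exp (4 * u) := Real.exp_le_exp.2 (by linarith)
    have h3 := mul_le_mul_of_nonneg_left h2 hπ.le
    linarith
  · have h2 : Real.exp (4 * c) ≤ Real.exp (4 * u) := Real.exp_le_exp.2 (by linarith)
    have h3 := mul_le_mul_of_nonneg_left h2 hπ.le
    have h4 : 0 ≤ (k : ℝ) / u ^ 2 := by positivity
    nlinarith

/-- **Left floor**: `W_k″(u) ≥ k/b² + 16π` for `0 < u < b`. [cite: GORZPNAS2019, Thm 7 and §5.1] -/
theorem xiPotential_floor_left (k : ℕ) {b : ℝ} :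
    ∀ u : ℝ, 0 < u → u < b →
      (k : ℝ) / b ^ 2 + 16 * Real.pi ≤
        (k : ℝ) / u ^ 2 +
          (deBruijnPhiDeriv u ^ 2 - deBruijnPhi u * deBruijnPhiDeriv₂ u) / deBruijnPhi u ^ 2 := by
  intro u hu hub
  have hlt := xiPotentialDeriv₂_gt k hu
  have hπ : 0 < 16 * Real.pi := by positivity
  have h1 : (k : ℝ) / b ^ 2 ≤ (k : ℝ) / u ^ 2 :=
    div_le_div_of_nonneg_left (Nat.cast_nonneg k) (by positivity) (pow_le_pow_left₀ hu.le hub.le 2)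
  have h2 : (1 : ℝ) ≤ Real.exp (4 * u) := Real.one_le_exp (by positivity)
  have h3 := mul_le_mul_of_nonneg_left h2 hπ.le
  linarith

/-! ### The Brascamp–Lieb bound for the second moment about the mode -/

/-- **Second moment of `u^kΦ(u)du` about a critical point `a` of `W_k`** under a two-piece
curvature floor (`W_k″ ≥ ρ` on `[b,∞)`, `≥ ρ′` on `(0,b)`):
`∫₀^∞ (u − a)² u^kΦ ≤ ρ⁻¹ M_k + ρ′⁻¹ ∫₀^b u^kΦ` (Brascamp–Lieb on `(0, ∞)`,
`BrascampLiebHalfLine`). [cite: BrascampLieb1976, Thm 4.1 (n = 1)] -/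
theorem integral_sq_sub_mul_phi_pow_le (k : ℕ) {a b ρ ρ' : ℝ} (ha : 0 < a)
    (hmode : (k : ℝ) / a + deBruijnPhiDeriv a / deBruijnPhi a = 0)
    (hρ : 0 < ρ) (hρ' : 0 < ρ')
    (hfloor : ∀ u : ℝ, 0 < u → b ≤ u → ρ ≤ (k : ℝ) / u ^ 2 +
      (deBruijnPhiDeriv u ^ 2 - deBruijnPhi u * deBruijnPhiDeriv₂ u) / deBruijnPhi u ^ 2)
    (hfloor' : ∀ u : ℝ, 0 < u → u < b → ρ' ≤ (k : ℝ) / u ^ 2 +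
      (deBruijnPhiDeriv u ^ 2 - deBruijnPhi u * deBruijnPhiDeriv₂ u) / deBruijnPhi u ^ 2) :
    IntegrableOn (fun u => (u - a) ^ 2 * (deBruijnPhi u * u ^ k)) (Ioi 0) ∧
    ∫ u in Ioi 0, (u - a) ^ 2 * (deBruijnPhi u * u ^ k) ≤
      ρ⁻¹ * xiMoment k + ρ'⁻¹ * ∫ u in Ioo 0 b, deBruijnPhi u * u ^ k := by
  set g : ℝ → ℝ := fun t => -((k : ℝ) * Real.log t + Real.log (deBruijnPhi t)) with hg
  set g₁ : ℝ → ℝ := fun t => -((k : ℝ) / t + deBruijnPhiDeriv t / deBruijnPhi t) with hg₁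
  set g₂ : ℝ → ℝ := fun t => (k : ℝ) / t ^ 2 +
    (deBruijnPhiDeriv t ^ 2 - deBruijnPhi t * deBruijnPhiDeriv₂ t) / deBruijnPhi t ^ 2 with hg₂
  have hgd : ∀ x ∈ Ioi (0 : ℝ), HasDerivAt g (g₁ x) x := fun x hx => hasDerivAt_xiPotential k hx
  have hg₁d : ∀ x ∈ Ioi (0 : ℝ), HasDerivAt g₁ (g₂ x) x :=
    fun x hx => hasDerivAt_xiPotentialDeriv k hx
  have hg₂c : ContinuousOn g₂ (Ioi 0) := continuousOn_xiPotentialDeriv₂ k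
  have hpos : ∀ x ∈ Ioi (0 : ℝ), 0 < g₂ x := fun x hx => xiPotentialDeriv₂_pos k hx
  have hga : g₁ a = 0 := by simp only [hg₁, hmode, neg_zero]
  have hexp : EqOn (fun x => Real.exp (-g x)) (fun x => deBruijnPhi x * x ^ k) (Ioi 0) :=
    fun x hx => exp_neg_xiPotential k hx
  have hint : IntegrableOn (fun x => Real.exp (-g x)) (Ioi 0) :=
    (integrableOn_deBruijnPhi_mul_pow k).congr_fun hexp.symm measurableSet_Ioi
  obtain ⟨hI, hle⟩ := integral_sq_sub_mul_exp_neg_le_of_curvature ha hgd hg₁d hg₂c hpos hga hρ hρ'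
    (fun x hx hb => hfloor x hx hb) (fun x hx hb => hfloor' x hx hb) hint
  have hexp2 : EqOn (fun x => (x - a) ^ 2 * Real.exp (-g x))
      (fun x => (x - a) ^ 2 * (deBruijnPhi x * x ^ k)) (Ioi 0) := by
    intro x hx; simp only [hexp hx]
  refine ⟨hI.congr_fun hexp2 measurableSet_Ioi, ?_⟩
  have e0 : ∫ u in Ioi 0, (u - a) ^ 2 * Real.exp (-g u) =
      ∫ u in Ioi 0, (u - a) ^ 2 * (deBruijnPhi u * u ^ k) :=
    setIntegral_congr_fun measurableSet_Ioi hexp2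
  have e1 : ∫ u in Ioi 0 ∩ Ici b, Real.exp (-g u) = ∫ u in Ioi 0 ∩ Ici b, deBruijnPhi u * u ^ k :=
    setIntegral_congr_fun (measurableSet_Ioi.inter measurableSet_Ici) fun x hx => hexp hx.1
  have e2 : ∫ u in Ioi 0 ∩ Iio b, Real.exp (-g u) = ∫ u in Ioo 0 b, deBruijnPhi u * u ^ k := by
    rw [setIntegral_congr_fun (measurableSet_Ioi.inter measurableSet_Iio) fun x hx => hexp hx.1,
      Ioi_inter_Iio]
  have hle1 : ∫ u in Ioi 0 ∩ Ici b, deBruijnPhi u * u ^ k ≤ xiMoment k := by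
    refine setIntegral_mono_set (integrableOn_deBruijnPhi_mul_pow k) ?_
      inter_subset_left.eventuallyLE
    exact (ae_restrict_iff' measurableSet_Ioi).2 (ae_of_all _ fun u hu =>
      (mul_pos (deBruijnPhi_pos_holds u) (pow_pos hu k)).le)
  rw [e0, e1, e2] at hle
  have := mul_le_mul_of_nonneg_left hle1 (inv_nonneg.2 hρ.le)
  linarith

/-- **Brascamp–Lieb bound for the variance and the mean of `ν_k ∝ u^kΦ(u)du`**: with
`P = (∫₀^b u^kΦ)/M_k` the mass below the cut, `m₂(k)·ū_k² ≤ ρ⁻¹ + ρ′⁻¹P` and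
`(ū_k − a)² ≤ ρ⁻¹ + ρ′⁻¹P` (`m₂ = xiCM k 2`, `ū_k = xiMean k`; variance ≤ second moment about
`a`, and Jensen). [cite: BrascampLieb1976, Thm 4.1 (n = 1)] -/
theorem xiCM_two_mul_sq_xiMean_le (k : ℕ) {a b ρ ρ' : ℝ} (ha : 0 < a)
    (hmode : (k : ℝ) / a + deBruijnPhiDeriv a / deBruijnPhi a = 0)
    (hρ : 0 < ρ) (hρ' : 0 < ρ')
    (hfloor : ∀ u : ℝ, 0 < u → b ≤ u → ρ ≤ (k : ℝ) / u ^ 2 +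
      (deBruijnPhiDeriv u ^ 2 - deBruijnPhi u * deBruijnPhiDeriv₂ u) / deBruijnPhi u ^ 2)
    (hfloor' : ∀ u : ℝ, 0 < u → u < b → ρ' ≤ (k : ℝ) / u ^ 2 +
      (deBruijnPhiDeriv u ^ 2 - deBruijnPhi u * deBruijnPhiDeriv₂ u) / deBruijnPhi u ^ 2) :
    xiCM k 2 * xiMean k ^ 2 ≤ ρ⁻¹ + ρ'⁻¹ * ((∫ u in Ioo 0 b, deBruijnPhi u * u ^ k) / xiMoment k) ∧
    (xiMean k - a) ^ 2 ≤ ρ⁻¹ + ρ'⁻¹ * ((∫ u in Ioo 0 b, deBruijnPhi u * u ^ k) / xiMoment k) := by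
  obtain ⟨h2, hle⟩ := integral_sq_sub_mul_phi_pow_le k ha hmode hρ hρ' hfloor hfloor'
  set w : ℝ → ℝ := fun u => deBruijnPhi u * u ^ k with hw
  have hw0 : ∀ u ∈ Ioi (0 : ℝ), 0 ≤ w u :=
    fun u hu => (mul_pos (deBruijnPhi_pos_holds u) (pow_pos hu k)).le
  have h0 : IntegrableOn w (Ioi 0) := integrableOn_deBruijnPhi_mul_pow k
  have hZ : 0 < ∫ u in Ioi 0, w u := xiMoment_pos k
  have hZeq : ∫ u in Ioi 0, w u = xiMoment k := rfl
  -- the first moment is `M_{k+1}`, so the mean is `xiMean k`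
  have hfirst : ∫ u in Ioi 0, u * w u = xiMoment (k + 1) := by
    rw [xiMoment]; refine setIntegral_congr_fun measurableSet_Ioi fun u _ => ?_
    simp only [hw]; ring
  have hmean : (∫ u in Ioi 0, u * w u) / (∫ u in Ioi 0, w u) = xiMean k := by
    rw [hfirst, hZeq, xiMean]
  obtain ⟨-, hJ⟩ := sq_mean_sub_le_div measurableSet_Ioi hw0 h0 h2 hZ
  obtain ⟨-, hV⟩ := integral_sq_sub_mean_le measurableSet_Ioi hw0 h0 h2 hZ
  rw [hmean] at hJ hV
  rw [hZeq] at hJ hV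
  have hM := xiMoment_pos k
  -- the bound `B₀` on the normalised second moment about `a`
  have hB : (∫ u in Ioi 0, (u - a) ^ 2 * w u) / xiMoment k ≤
      ρ⁻¹ + ρ'⁻¹ * ((∫ u in Ioo 0 b, deBruijnPhi u * u ^ k) / xiMoment k) := by
    rw [div_le_iff₀ hM]
    have : (ρ⁻¹ + ρ'⁻¹ * ((∫ u in Ioo 0 b, deBruijnPhi u * u ^ k) / xiMoment k)) * xiMoment k =
        ρ⁻¹ * xiMoment k + ρ'⁻¹ * ∫ u in Ioo 0 b, deBruijnPhi u * u ^ k := by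
      field_simp
    rw [this]; exact hle
  refine ⟨?_, hJ.trans hB⟩
  -- `xiCM k 2 · ū² = (∫ (u - ū)² w)/M_k`
  have hū := xiMean_pos k
  have hcm : xiCM k 2 * xiMean k ^ 2 = (∫ u in Ioi 0, (u - xiMean k) ^ 2 * w u) / xiMoment k := by
    rw [xiCM]
    have : (fun u => deBruijnPhi u * u ^ k * (u / xiMean k - 1) ^ 2) =
        fun u => (xiMean k ^ 2)⁻¹ * ((u - xiMean k) ^ 2 * w u) := by
      funext u; simp only [hw]; field_simp
    rw [this, integral_const_mul]
    field_simp
  rw [hcm, hV]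
  have hsq : 0 ≤ xiMoment k * (xiMean k - a) ^ 2 := by positivity
  calc ((∫ u in Ioi 0, (u - a) ^ 2 * w u) - xiMoment k * (xiMean k - a) ^ 2) / xiMoment k
      ≤ (∫ u in Ioi 0, (u - a) ^ 2 * w u) / xiMoment k :=
        div_le_div_of_nonneg_right (by linarith) hM.le
    _ ≤ _ := hB

/-- **Mean versus mode**: `(ū_k − a)² ≤ ρ⁻¹ + ρ′⁻¹P` (the second half of
`xiCM_two_mul_sq_xiMean_le`, stated on its own). [cite: BrascampLieb1976, Thm 4.1 (n = 1)] -/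
theorem sq_xiMean_sub_le (k : ℕ) {a b ρ ρ' : ℝ} (ha : 0 < a)
    (hmode : (k : ℝ) / a + deBruijnPhiDeriv a / deBruijnPhi a = 0)
    (hρ : 0 < ρ) (hρ' : 0 < ρ')
    (hfloor : ∀ u : ℝ, 0 < u → b ≤ u → ρ ≤ (k : ℝ) / u ^ 2 +
      (deBruijnPhiDeriv u ^ 2 - deBruijnPhi u * deBruijnPhiDeriv₂ u) / deBruijnPhi u ^ 2)
    (hfloor' : ∀ u : ℝ, 0 < u → u < b → ρ' ≤ (k : ℝ) / u ^ 2 +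
      (deBruijnPhiDeriv u ^ 2 - deBruijnPhi u * deBruijnPhiDeriv₂ u) / deBruijnPhi u ^ 2) :
    (xiMean k - a) ^ 2 ≤ ρ⁻¹ + ρ'⁻¹ * ((∫ u in Ioo 0 b, deBruijnPhi u * u ^ k) / xiMoment k) :=
  (xiCM_two_mul_sq_xiMean_le k ha hmode hρ hρ' hfloor hfloor').2

/-- **The effective upper bound for `μ₂(n)`** (LADDER-BL (5.2)/(5.4) with the mean–mode step by
Jensen): for `k = 2n`, a critical point `a > 0` of `W_k`, floors `ρ, ρ′` as above and any
`B ≥ ρ⁻¹ + ρ′⁻¹P` with `√B < a`:  `a − √B ≤ ū_{2n}` and `μ₂(n) ≤ (2n+1)·B/(a − √B)²`.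
[cite: GORZPNAS2019, Thm 7 and §5.1] -/
theorem xiMu_two_le_of_curvature (n : ℕ) {a b ρ ρ' B : ℝ} (ha : 0 < a)
    (hmode : 2 * (n : ℝ) / a + deBruijnPhiDeriv a / deBruijnPhi a = 0)
    (hρ : 0 < ρ) (hρ' : 0 < ρ')
    (hfloor : ∀ u : ℝ, 0 < u → b ≤ u → ρ ≤ 2 * (n : ℝ) / u ^ 2 +
      (deBruijnPhiDeriv u ^ 2 - deBruijnPhi u * deBruijnPhiDeriv₂ u) / deBruijnPhi u ^ 2)
    (hfloor' : ∀ u : ℝ, 0 < u → u < b → ρ' ≤ 2 * (n : ℝ) / u ^ 2 +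
      (deBruijnPhiDeriv u ^ 2 - deBruijnPhi u * deBruijnPhiDeriv₂ u) / deBruijnPhi u ^ 2)
    (hB : ρ⁻¹ + ρ'⁻¹ * ((∫ u in Ioo 0 b, deBruijnPhi u * u ^ (2 * n)) / xiMoment (2 * n)) ≤ B)
    (hBa : Real.sqrt B < a) :
    a - Real.sqrt B ≤ xiMean (2 * n) ∧
    xiMu n 2 ≤ (2 * n + 1) * B / (a - Real.sqrt B) ^ 2 := by
  have hcast : ((2 * n : ℕ) : ℝ) = 2 * (n : ℝ) := by push_cast; ring
  have hmode' : ((2 * n : ℕ) : ℝ) / a + deBruijnPhiDeriv a / deBruijnPhi a = 0 := by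
    rw [hcast]; exact hmode
  have hfl : ∀ u : ℝ, 0 < u → b ≤ u → ρ ≤ ((2 * n : ℕ) : ℝ) / u ^ 2 +
      (deBruijnPhiDeriv u ^ 2 - deBruijnPhi u * deBruijnPhiDeriv₂ u) / deBruijnPhi u ^ 2 := by
    intro u hu hbu; rw [hcast]; exact hfloor u hu hbu
  have hfl' : ∀ u : ℝ, 0 < u → u < b → ρ' ≤ ((2 * n : ℕ) : ℝ) / u ^ 2 +
      (deBruijnPhiDeriv u ^ 2 - deBruijnPhi u * deBruijnPhiDeriv₂ u) / deBruijnPhi u ^ 2 := by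
    intro u hu hub; rw [hcast]; exact hfloor' u hu hub
  obtain ⟨hcm, hmean⟩ := xiCM_two_mul_sq_xiMean_le (2 * n) ha hmode' hρ hρ' hfl hfl'
  have hcmB : xiCM (2 * n) 2 * xiMean (2 * n) ^ 2 ≤ B := hcm.trans hB
  have hmeanB : (xiMean (2 * n) - a) ^ 2 ≤ B := hmean.trans hB
  have hB0 : 0 ≤ B := le_trans (sq_nonneg _) hmeanB
  have hsB : 0 ≤ Real.sqrt B := Real.sqrt_nonneg _
  -- `|ū - a| ≤ √B`, hence `ū ≥ a - √B > 0`
  have habs : |xiMean (2 * n) - a| ≤ Real.sqrt B := by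
    rw [← Real.sqrt_sq_eq_abs]; exact Real.sqrt_le_sqrt hmeanB
  have hlow : a - Real.sqrt B ≤ xiMean (2 * n) := by
    have := neg_abs_le (xiMean (2 * n) - a); linarith
  refine ⟨hlow, ?_⟩
  have hpos : 0 < a - Real.sqrt B := by linarith
  have hū := xiMean_pos (2 * n)
  -- `xiMu n 2 = (2n+1) · xiCM (2n) 2`
  have hδ : deltaOne n ^ 2 = 1 / (2 * n + 1) := by
    rw [deltaOne_sq, GORZAsymp.yseq]; field_simp
  have hmu : xiMu n 2 = (2 * n + 1) * xiCM (2 * n) 2 := by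
    rw [xiMu, hδ]; field_simp
  rw [hmu]
  have h1 : xiCM (2 * n) 2 ≤ B / xiMean (2 * n) ^ 2 := by
    rw [le_div_iff₀ (pow_pos hū 2)]; exact hcmB
  have h2 : B / xiMean (2 * n) ^ 2 ≤ B / (a - Real.sqrt B) ^ 2 :=
    div_le_div_of_nonneg_left hB0 (pow_pos hpos 2) (pow_le_pow_left₀ hpos.le hlow 2)
  have h3 : (0 : ℝ) ≤ 2 * n + 1 := by positivity
  calc (2 * n + 1) * xiCM (2 * n) 2 ≤ (2 * n + 1) * (B / (a - Real.sqrt B) ^ 2) :=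
        mul_le_mul_of_nonneg_left (h1.trans h2) h3
    _ = (2 * n + 1) * B / (a - Real.sqrt B) ^ 2 := by ring

end Literature.NumberTheory.LFunctions
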